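import Summits.QuantumFields.YangMills.Theorems.BalabanUVNodesN15KingModelGraphTreeDecayExtLegs

/-!
# BalabanUVNodes ∕ N15 — THE KING-MODEL RUNG (PART Α-l): THEOREM 3.5 (i) (3.38)'s SHAPE WITH KING's OWN EXTERNAL LINES — the SIZE of a connected graph whose
# internal lines carry King's full `A = 0` propagators and whose external lines are `ℋ_K(·, y_υ)` ∕ `∂ℋ_K` to unit sites decays exponentially in the tree length
# of the external points, with NO abstract hypothesis left: `|E^{(K)}(H)| ≤ exp[−δ·d_tree({y_υ})]·Q·c368(δ)·C₁^m·C₂^{nn}·(Σ_π degConst)·Q^{|Υ|−1}`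
# (Track A, DAG node N15 = NE2; FAN-OUT v1.1 §N15 s3 «KING-MODEL RUNG … NE2's analogue DECIDED in the model»)

HONEST FRAMING.  Count-neutral (cell `pub-ymgap`, seat `pub-ymgap-dag-n15-e` g29; `--supports stmt-QuantumFields-27366 --as helper` = K3⁸
`SpineGivenEndpointR13SepCoPHV`).  TEMPLATE LITERATURE: C. King, *The U(1) Higgs model. I. The continuum limit*, Commun. Math. Phys. **102** (1986) 649–677
[King1986], Theorem 3.5 (i) (3.38) p. 660 (the size of a localised graph with tree decay in its external points) read for the graphs of Proposition 3.6 in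
KING's OWN `A = 0` MODEL: internal lines `G^η_K`∕`∂^η_μG^η_K` (Prop. 3.7 BY NAME), external lines (3.71)'s kernels `ℋ_K = a_KG^η_KQ_K^*` (sizes by Thm 3.3 ∕ [Ba4]
(1.10), part Η-e).  NOT Bałaban's `G(U)`; NOT a node discharge; nothing continuum ∕ ℝ⁴ ∕ OS ∕ mass-gap ∕ Clay.  0 `sorry`; standard axioms.  Text layer of pp.
660–664 (`paper:king1986-cmp102-king-u1-higgs-i` p0012–p0016) re-read by this seat 2026-08-29.

THE PRINT.  p. 660 [PDF 12], Theorem 3.5 (i) (3.38): *«|E^{(θ)}(H, A^{(θ)}; {y_i}, {z_j})| ≤ C(L^kε)^{…}(p(L^kε))^{n₁} exp[−δ dist({y_i}, {z_j})], where θ is k or k + n»*,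
with *«dist({u_i}) … the length of the shortest tree graph connecting {u_i}»*.

WHAT THIS FILE PROVES (namespace `Summit.QuantumFields.YangMills.BalabanUVNodes.N15KingModelRung.Curved`).
* ★★★ **`king_graph_size_extLegs_treeDecay`** — for odd `L ≥ 3`, `a > 0`, `m₀² ≥ 0` there are `C₁, C₂, Q, δ > 0` such that for every mass `0 < m² ≤ m₀²`, index
  `jv`, every CONNECTED numbered graph (kinds `κ`) whose King degrees are positive along every ordering ((3.77) verbatim, `PosDegrees (kingDegList …)`), and every
  family of King's external lines (blocks `b_υ`, kinds `κₑ_υ`, one at the vertex `0`):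
  `|E^{(K)}(H)| ≤ exp[−δ·treeLength |·| {y_υ}]·(Q·c368(δ))·C₁^m·C₂^{nn}·(Σ_π degConst L (kingDegList …))·Π_{υ≠υ₀} Q` — part Α-f's `king_graph_size_treeDecay_kruskal`
  with the legs of part Α-g `kingExt_legs_anchored` (rate `δ = δ_E∕2`: half to the root leg's `L¹` majorant `Q·e^{−δ|x − y₀|}`, `Σ ≤ Q·c368(δ)` by (3.68), half
  to the tree); NOTHING depends on the volume.
* ★★ `king_graph_size_extLegs_treeDecay_subgraphs` — the same under p. 664's sentence `PosSubgraphsBy src tgt 0 (d+1) (lineExp ∘ κ)` (part Δ-b).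

HONEST SCOPE.  (a) The size with tree decay for (3.56)-type graphs; Theorem 3.5's own graphs carry fields and sources (abstract in parts Α-f∕Α-k); §3.5 NOT typed.
(b) `treeLength` = minimum over connecting edge sets (King's tree minimum by pruning, not typed).  Locators: [King1986] Thm 3.5 (3.38) p.660, Prop. 3.8 (3.71)
p.664, Thm 3.3 (3.7) p.658, (3.68) p.664, (3.77) p.666, p.664.
-/

noncomputable section

namespace Summit.QuantumFields.YangMills.BalabanUVNodes.N15KingModelRung.Curved

open scoped BigOperators
open Finset
open Literature.MathematicalPhysics.QuantumFieldTheory.Balaban1983to89.B5Prop11Plancherel (Tor fine)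
open Literature.MathematicalPhysics.QuantumFieldTheory.King1986.Torus (tdistT tdistT_nonneg)
open Literature.MathematicalPhysics.QuantumFieldTheory.King1986.ContinuumLimit (eps)
open Summit.QuantumFields.YangMills.BalabanUVNodes.N15KingModelRung (KingVolIndex kingVol kingVol_neZero basePt)
open Summit.QuantumFields.YangMills.BalabanUVNodes.N15KingModelRung.Graph

variable {d : ℕ} (L : ℕ) [NeZero L]

section SizeExtLegs

/-- ★★★ **THEOREM 3.5 (i) (3.38)'s SHAPE WITH KING's OWN EXTERNAL LINES, BY NAME AT `A = 0`**: for odd `L ≥ 3`, `a > 0`, `m₀² ≥ 0` there are `C₁, C₂, Q, δ > 0`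
such that for every mass `0 < m² ≤ m₀²`, index `jv` (torus `2L^{jv.m}`, `K = jv.K ≥ 1`), every CONNECTED numbered graph with King's full `A = 0` propagators on
its lines (kinds `κ`) and positive King degrees along every ordering ((3.77) verbatim), and every family of EXTERNAL LINES `υ` (from `vtx υ` to `y_υ = basePt b_υ`,
kind `κₑ_υ`, carrying `ℋ_K(·, y_υ)`∕`∂ℋ_K`; `υ₀` at the vertex `0`):
`|E^{(K)}(H)| ≤ exp[−δ·treeLength |·| {y_υ}]·((Q·c368 d δ)·(C₁^m·C₂^{nn}·(Σ_π degConst L (kingDegList …))·Π_{υ≠υ₀} Q))` — the size decays exponentially in the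
tree length of the external points; no volume factor. [cite: King1986, Thm 3.5 (3.38) p.660, p.664 («extracting a small part of each propagator»), Prop. 3.8
(3.71) p.664, Thm 3.3 (3.7) p.658, (3.68) p.664, (3.77) p.666] -/
theorem king_graph_size_extLegs_treeDecay (hLodd : Odd L) (hL : 2 ≤ L) {a : ℝ} (ha : 0 < a) {m0sq : ℝ} (hm0 : 0 ≤ m0sq) :
    ∃ C₁ C₂ Q δ : ℝ, 0 < C₁ ∧ 0 < C₂ ∧ 0 < Q ∧ 0 < δ ∧ ∀ (msq : ℝ), 0 < msq → msq ≤ m0sq → ∀ (jv : KingVolIndex d)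
      (nn m : ℕ) (src tgt : Fin m → Fin (nn + 1)), (∀ v, LConn src tgt univ 0 v) →
      ∀ (κ : Fin m → Option (Fin (d + 1))),
        (∀ π : Equiv.Perm (Fin m), PosDegrees (kingDegList src tgt ((d + 1 : ℕ) : ℝ) (fun ℓ => lineExp (d + 1) (κ ℓ)) π)) →
      ∀ (Υ : Type) [Fintype Υ] [DecidableEq Υ] (vtx : Υ → Fin (nn + 1)) (υ₀ : Υ), vtx υ₀ = 0 →
      ∀ (b : Υ → Tor (kingVol L jv)) (κe : Υ → Option (Fin (d + 1))),
        haveI := kingVol_neZero L jv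
        |graphValLS ((((L : ℝ) ^ jv.K)⁻¹) ^ (d + 1)) src tgt (fun ℓ => kingGLine L (kingVol L jv) a msq jv.K (κ ℓ)) vtx
            (fun υ => kingExtLo L a msq jv (b υ) (κe υ))|
          ≤ Real.exp (-(δ * treeLength (kingDist L jv) (anchors fun υ => some (basePt (L ^ jv.K) (kingVol L jv) (b υ)))))
            * ((Q * c368 d δ) * (C₁ ^ m * C₂ ^ nn
                * (∑ π : Equiv.Perm (Fin m), degConst L (kingDegList src tgt ((d + 1 : ℕ) : ℝ) (fun ℓ => lineExp (d + 1) (κ ℓ)) π))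
                * ∏ _υ ∈ univ.erase υ₀, Q)) := by
  obtain ⟨C₁, C₂, δ₁, hC₁, hC₂, hδ₁, H⟩ := king_graph_size_treeDecay_kruskal (d := d) L hLodd hL ha hm0
  obtain ⟨Q, δE, γE, hQ, hδE, -, HE⟩ := kingExt_legs_anchored (d := d) L hLodd hL ha hm0
  have hL1 : 1 ≤ L := by omega
  have hL0 : (0 : ℝ) < L := by exact_mod_cast (show 0 < L by omega)
  set δ : ℝ := min δ₁ (δE / 2) with hδdef
  have hδ0 : 0 < δ := lt_min hδ₁ (by linarith)
  refine ⟨C₁, C₂, Q, δ, hC₁, hC₂, hQ, hδ0, fun msq hm hcap jv nn m src tgt hconn κ hking Υ _ _ vtx υ₀ hυ₀ b κe => ?_⟩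
  haveI := kingVol_neZero L jv
  have hρ0 := kingDist_nonneg L jv
  set ρ := kingDist L jv with hρ
  set y : Υ → Tor (fine (L ^ jv.K) (kingVol L jv)) := fun υ => basePt (L ^ jv.K) (kingVol L jv) (b υ) with hy
  -- the legs at rate `2δ ≤ δ_E` (the `n = 1` fine run is irrelevant for the coarse sizes)
  have h2δ : 2 * δ ≤ δE := by have := min_le_right δ₁ (δE / 2); rw [← hδdef] at this; linarith
  have HL := fun υ => HE msq hm hcap jv 1 le_rfl (b υ) (κe υ) (2 * δ) (by linarith) h2δ
  have hsplit : ∀ x z : Tor (fine (L ^ jv.K) (kingVol L jv)),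
      Real.exp (-(2 * δ * ρ x z)) = Real.exp (-(δ * ρ x z)) * legWeight δ ρ (some z) x := fun x z => by
    rw [legWeight_some, ← Real.exp_add]; congr 1; ring
  have hw1 : ∀ x z : Tor (fine (L ^ jv.K) (kingVol L jv)), Real.exp (-(δ * ρ x z)) ≤ 1 := fun x z =>
    Real.exp_le_one_iff.2 (neg_nonpos.2 (mul_nonneg hδ0.le (hρ0 x z)))
  -- the root leg's `L¹` majorant as a unit-slice profile
  set p₀ : Tor (fine (L ^ jv.K) (kingVol L jv)) → ℝ := fun x => profileAt L jv.K (kingVol L jv) Q δ jv.K 0 x (y υ₀) with hp₀def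
  have hp₀eq : ∀ x, p₀ x = Q * Real.exp (-(δ * ρ x (y υ₀))) := fun x => profileAt_top_eq L jv Q δ x (y υ₀)
  have hp₀0 : ∀ x, 0 ≤ p₀ x := fun x => by rw [hp₀eq]; positivity
  have h1K : (1 : ℝ) = ((L : ℝ) ^ jv.K * eps L jv.K) := by unfold eps; rw [mul_inv_cancel₀ (pow_ne_zero _ hL0.ne')]
  have hΓ : ∑ x, (((L : ℝ) ^ jv.K)⁻¹) ^ (d + 1) * p₀ x ≤ Q * c368 d δ := by
    have h := lineSum_profileAt_col L hL1 (kingVol L jv) hQ.le hδ0 jv.K 0 (y υ₀)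
    rw [← h1K, Real.one_rpow, mul_one] at h
    exact h
  -- the legs' letters in the form part Α-f's size theorem consumes (`kingDist` unfolds to `tdistT∕L^K`)
  have hρK : (fun x y => tdistT (fine (L ^ jv.K) (kingVol L jv)) x y / (L : ℝ) ^ jv.K) = ρ := by rw [hρ]; rfl
  have hu : ∀ υ, υ ≠ υ₀ → ∀ x, |kingExtLo L a msq jv (b υ) (κe υ) x|
      ≤ Q * legWeight δ (fun x y => tdistT (fine (L ^ jv.K) (kingVol L jv)) x y / (L : ℝ) ^ jv.K) ((fun υ => some (y υ)) υ) x := fun υ _ x => by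
    rw [hρK]
    have h := (HL υ).1 x
    rw [hsplit] at h
    exact (h.trans (le_of_eq (by ring))).trans
      (mul_le_mul_of_nonneg_right (mul_le_of_le_one_right hQ.le (hw1 x _)) (legWeight_pos _ _ _ _).le)
  have hu₀ : ∀ x, |kingExtLo L a msq jv (b υ₀) (κe υ₀) x|
      ≤ p₀ x * legWeight δ (fun x y => tdistT (fine (L ^ jv.K) (kingVol L jv)) x y / (L : ℝ) ^ jv.K) ((fun υ => some (y υ)) υ₀) x := fun x => by
    rw [hρK]
    have h := (HL υ₀).1 x
    rw [hsplit] at h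
    rw [hp₀eq]
    exact h.trans (le_of_eq (by ring))
  have key := H jv.K jv.m jv.one_le_K (kingVol L jv) (fun _ => rfl) msq hm hcap nn m src tgt hconn κ Υ vtx υ₀ hυ₀ (fun υ => some (y υ)) δ hδ0.le
    (fun υ => kingExtLo L a msq jv (b υ) (κe υ)) (fun _ => Q) p₀ (Q * c368 d δ) (fun _ => hQ.le) hp₀0 hu hu₀ hΓ hking
  have hminδ : min δ₁ δ = δ := min_eq_right (min_le_left _ _)
  rw [hminδ, hρK] at key
  exact key

/-- ★★ **… UNDER p. 664's SENTENCE «EVERY SUBGRAPH HAS POSITIVE DEGREE»** (`PosSubgraphsBy src tgt 0 (d+1) (lineExp ∘ κ)`, part Δ-b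
`posDegreesBy_kingDegList_of_posSubgraphsBy`): the size with its tree decay for every connected `G`∕`∂G` graph satisfying it, with King's external lines.
[cite: King1986, Thm 3.5 (3.38) p.660, p.664 («every subgraph has positive degree»), (3.77) p.666] -/
theorem king_graph_size_extLegs_treeDecay_subgraphs (hLodd : Odd L) (hL : 2 ≤ L) {a : ℝ} (ha : 0 < a) {m0sq : ℝ} (hm0 : 0 ≤ m0sq) :
    ∃ C₁ C₂ Q δ : ℝ, 0 < C₁ ∧ 0 < C₂ ∧ 0 < Q ∧ 0 < δ ∧ ∀ (msq : ℝ), 0 < msq → msq ≤ m0sq → ∀ (jv : KingVolIndex d)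
      (nn m : ℕ) (src tgt : Fin m → Fin (nn + 1)), (∀ v, LConn src tgt univ 0 v) →
      ∀ (κ : Fin m → Option (Fin (d + 1))), PosSubgraphsBy src tgt 0 ((d + 1 : ℕ) : ℝ) (fun ℓ => lineExp (d + 1) (κ ℓ)) →
      ∀ (Υ : Type) [Fintype Υ] [DecidableEq Υ] (vtx : Υ → Fin (nn + 1)) (υ₀ : Υ), vtx υ₀ = 0 →
      ∀ (b : Υ → Tor (kingVol L jv)) (κe : Υ → Option (Fin (d + 1))),
        haveI := kingVol_neZero L jv
        |graphValLS ((((L : ℝ) ^ jv.K)⁻¹) ^ (d + 1)) src tgt (fun ℓ => kingGLine L (kingVol L jv) a msq jv.K (κ ℓ)) vtx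
            (fun υ => kingExtLo L a msq jv (b υ) (κe υ))|
          ≤ Real.exp (-(δ * treeLength (kingDist L jv) (anchors fun υ => some (basePt (L ^ jv.K) (kingVol L jv) (b υ)))))
            * ((Q * c368 d δ) * (C₁ ^ m * C₂ ^ nn
                * (∑ π : Equiv.Perm (Fin m), degConst L (kingDegList src tgt ((d + 1 : ℕ) : ℝ) (fun ℓ => lineExp (d + 1) (κ ℓ)) π))
                * ∏ _υ ∈ univ.erase υ₀, Q)) := by
  obtain ⟨C₁, C₂, Q, δ, hC₁, hC₂, hQ, hδ, H⟩ := king_graph_size_extLegs_treeDecay (d := d) L hLodd hL ha hm0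
  refine ⟨C₁, C₂, Q, δ, hC₁, hC₂, hQ, hδ, fun msq hm hcap jv nn m src tgt hconn κ hsub Υ _ _ vtx υ₀ hυ₀ b κe => ?_⟩
  exact H msq hm hcap jv nn m src tgt hconn κ
    (fun π => posDegrees_of_posDegreesBy le_rfl (posDegreesBy_kingDegList_of_posSubgraphsBy le_rfl hsub π)) Υ vtx υ₀ hυ₀ b κe

end SizeExtLegs

end Summit.QuantumFields.YangMills.BalabanUVNodes.N15KingModelRung.Curved

end
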